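import Literature.RingTheory.MvPolynomial.NoetherFormsGenericMinors
import Mathlib.Data.Nat.Choose.Bounds
import HarnessLib

/-!
# Effective Noether forms, Stage I (bounds): weights and norms of the generic minors

Support file for the proof of Kaltofen's Theorem 7 (`kaltofen1995_thm7`; E. Kaltofen, *Effective
Noether irreducibility forms and applications*, J. Comput. System Sci. 50 (1995) 274–295, §3).
Kaltofen's §3 (Lemma 1, Thms. 1–4, Cor. 1) bounds the degree in the generic coefficients `c's` and
the `1`-norm of the truncated root, of its powers and of the maximal minors `Δ` of the linear system
(Thm. 4: `deg Δ ≤ 12d⁶ - …`, `‖Δ‖₁ ≤ (2d)^{34d⁶}`).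

We prove the analogous statements for OUR generic objects (`NoetherFormsGenericRoot`,
`NoetherFormsGenericMinors`, generic case `a = MvPolynomial.X`), by different means:

* DEGREES through exact ISOBARICITY: with `w(c_{ij}) = d - i`, `w(z) = 1`, `w(y) = -(2d-2)` (the
  scaled `y`), `genF0`, `zpow`, `reduce`, `genQ`, `Nop`, `Abar` (weight `2 - d`), the columns
  (weight `i`), the entries `Mgen k (i,j)` (weight `i + (2d-2)k`), the minors and `tauR (S, ι)`
  (weight `W_S - ι`, `W_S = Σ_{c'} (2d-2) S c' + Σ_c c.1 ≤ Wτ d`) are weighted homogeneous;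
* NORMS through the weighted seminorm `polyNorm` at a small weight `t = 1/T d`, for which `Nop`
  followed by `reduce` is `½`-Lipschitz on the ball of radius `β` (a majorant argument replacing
  Kaltofen's Catalan-number induction): `‖[y^m] Ā_k‖₁ ≤ T^m`, whence
  `‖tauR (S, ι)‖₁ ≤ Bτ d`.

The final shapes `Wτ d ≤ 12 d⁶` and `Bτ d ≤ (2d)^{…}` are what Stage II consumes.

## References

* E. Kaltofen, J. Comput. System Sci. 50 (1995) 274–295, §3 (Lemma 1, Thms. 1–4). [`Kaltofen1995`]
-/

noncomputable section

open Polynomial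
open scoped Matrix

namespace Literature.RingTheory.MvPolynomial.NoetherForms

open _root_.MvPolynomial (IsWeightedHomogeneous isWeightedHomogeneous_X isWeightedHomogeneous_C
  isWeightedHomogeneous_one isWeightedHomogeneous_zero)

variable (d : ℕ)

/-- The generic coefficient vector `c_{ij} = X (i, j)`. [folklore] -/
abbrev aX (d : ℕ) : Idx d → E₂ d := MvPolynomial.X

/-- The (negative of the) weight of the scaled `y`: `s = 2d - 2`. [folklore] -/
def sW (d : ℕ) : ℤ := 2 * ((d : ℤ) - 1)

/-- `E₂[z]`. [folklore] -/
abbrev RzE (d : ℕ) := Polynomial (E₂ d)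

/-- `E₂[z][y]`. [folklore] -/
abbrev BE (d : ℕ) := Polynomial (RzE d)

/-! ### Weights: everything is isobaric -/

section Weights

/-- `c_{ij}` has weight `d - i`. [folklore] -/
theorem isWeightedHomogeneous_aX (ij : Idx d) :
    IsWeightedHomogeneous (wt d) (aX d ij) ((d : ℤ) - (ij.1 : ℕ)) :=
  isWeightedHomogeneous_X ℤ (wt d) ij

/-- `genF0` is `z`-graded of weight `d`. [folklore] -/
theorem ZHom_genF0 : ZHom (wt d) (genF0 d (aX d)) d := by
  unfold genF0
  refine ZHom.add (by simpa using (ZHom.X (w := wt d) (R := ℤ)).pow d) (ZHom.sum _ _ _ fun i _ => ?_)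
  have := (ZHom.C (isWeightedHomogeneous_aX d (i, 0))).mul ((ZHom.X (w := wt d) (R := ℤ)).pow i)
  convert this using 1
  push_cast
  ring

/-- Hasse derivatives lower the `z`-weight by their order. [folklore] -/
theorem ZHom.hasseDeriv {σ : Type*} {w : σ → ℤ} {P : Polynomial (MvPolynomial σ ℤ)} {W : ℤ}
    (hP : ZHom w P W) (k : ℕ) : ZHom w (Polynomial.hasseDeriv k P) (W - k) := by
  intro ι
  rw [hasseDeriv_coeff, ← map_natCast (MvPolynomial.C : ℤ →+* MvPolynomial σ ℤ)]
  refine IsWeightedHomogeneous.C_mul ?_ _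
  convert hP (ι + k) using 1
  push_cast
  ring

/-- Derivatives lower the `z`-weight by one. [folklore] -/
theorem ZHom.derivative' {σ : Type*} {w : σ → ℤ} {P : Polynomial (MvPolynomial σ ℤ)} {W : ℤ}
    (hP : ZHom w P W) : ZHom w (Polynomial.derivative P) (W - 1) := by
  have := hP.hasseDeriv 1
  rwa [hasseDeriv_one, Nat.cast_one] at this

/-- `δ̂` is `z`-graded of weight `d - 1`. [folklore] -/
theorem ZHom_deltaHat : ZHom (wt d) (deltaHat d (aX d)) ((d : ℤ) - 1) :=
  (ZHom_genF0 d).derivative'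

/-- `zpow k` is `z`-graded of weight `k`. [folklore] -/
theorem ZHom_zpow (k : ℕ) : ZHom (wt d) (zpow d (aX d) k) k := by
  induction k with
  | zero => simpa using ZHom.one (w := wt d) (R := ℤ)
  | succ k ih =>
    rw [zpow_succ]
    have h1 : ZHom (wt d) (X * zpow d (aX d) k) ((k : ℤ) + 1) := by
      simpa [add_comm] using (ZHom.X (w := wt d) (R := ℤ)).mul ih
    have h2 : IsWeightedHomogeneous (wt d) ((X * zpow d (aX d) k).coeff d) ((k : ℤ) + 1 - d) := h1 d
    have h3 := (ZHom.C h2).mul (ZHom_genF0 d)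
    push_cast
    refine h1.sub ?_
    convert h3 using 1
    ring

/-- `reduce` preserves the `z`-grading. [folklore] -/
theorem ZHom_reduce {P : RzE d} {W : ℤ} (hP : ZHom (wt d) P W) : ZHom (wt d) (reduce d (aX d) P) W := by
  rw [reduce_apply]
  refine ZHom.sum _ _ _ fun k _ => ?_
  have := (ZHom.C (hP k)).mul (ZHom_zpow d k)
  convert this using 1
  ring

/-- `eval₂ C H Q` is `(y,z)`-graded of weight `V` if `H` has weight `1` and the `hⁿ`-coefficient of `Q`
has `z`-weight `V - n`. [folklore] -/
theorem YZHom_eval₂_C {Q : BE d} {H : BE d} {V : ℤ} (hQ : ∀ n, ZHom (wt d) (Q.coeff n) (V - n))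
    (hH : YZHom (wt d) (sW d) H 1) : YZHom (wt d) (sW d) (Q.eval₂ C H) V := by
  rw [eval₂_eq_sum, Polynomial.sum_def]
  refine YZHom.sum _ _ _ fun n _ => ?_
  have := (YZHom.C (s := sW d) (hQ n)).mul (hH.pow n)
  convert this using 1
  ring

/-- The coefficients of `genQ` are `z`-graded of weight `d - 2 - n`. [folklore] -/
theorem ZHom_coeff_genQ (n : ℕ) : ZHom (wt d) ((genQ d (aX d)).coeff n) ((d : ℤ) - 2 - n) := by
  rw [coeff_genQ]
  convert (ZHom_genF0 d).hasseDeriv (n + 2) using 1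
  push_cast
  ring

/-- `Gat` at graded arguments of weights `1` and `0` is graded of weight `d`. [folklore] -/
theorem YZHom_Gat {x y : BE d} (hx : YZHom (wt d) (sW d) x 1) (hy : YZHom (wt d) (sW d) y 0) :
    YZHom (wt d) (sW d) (Gat d (cB ∘ aX d) x y) d := by
  unfold Gat
  refine YZHom.sum _ _ _ fun ij _ => ?_
  have h1 : YZHom (wt d) (sW d) ((cB ∘ aX d) (ij.1, ij.2.succ)) ((d : ℤ) - (ij.1 : ℕ)) :=
    YZHom.C (ZHom.C (isWeightedHomogeneous_aX d (ij.1, ij.2.succ)))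
  have := (h1.mul (hx.pow ij.1)).mul (hy.pow ij.2)
  convert this using 1
  ring

/-- `δB` is graded of weight `d - 1`. [folklore] -/
theorem YZHom_δB : YZHom (wt d) (sW d) (δB d (aX d)) ((d : ℤ) - 1) := YZHom.C (ZHom_deltaHat d)

/-- `Nop` maps weight `2 - d` to weight `2 - d`. [folklore] -/
theorem YZHom_Nop {A : BE d} (hA : YZHom (wt d) (sW d) A (2 - d)) :
    YZHom (wt d) (sW d) (Nop d (aX d) A) (2 - d) := by
  unfold Nop
  have hδA : YZHom (wt d) (sW d) (δB d (aX d) * A) 1 := by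
    convert (YZHom_δB d).mul hA using 1
    ring
  have hQ : YZHom (wt d) (sW d) ((genQ d (aX d)).eval₂ C (δB d (aX d) * A)) ((d : ℤ) - 2) :=
    YZHom_eval₂_C d (fun n => by convert ZHom_coeff_genQ d n using 1) hδA
  have hx : YZHom (wt d) (sW d) (C X + δB d (aX d) * A) 1 := (YZHom.C ZHom.X).add hδA
  have hy : YZHom (wt d) (sW d) (δB d (aX d) ^ 2 * X) 0 := by
    convert ((YZHom_δB d).pow 2).mul (YZHom.X (w := wt d) (R := ℤ) (s := sW d)) using 1
    rw [sW]
    push_cast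
    ring
  have h1 : YZHom (wt d) (sW d) (A ^ 2 * (genQ d (aX d)).eval₂ C (δB d (aX d) * A)) (2 - d) := by
    convert (hA.pow 2).mul hQ using 1
    push_cast
    ring
  have h2 : YZHom (wt d) (sW d) (X * Gat d (cB ∘ aX d) (C X + δB d (aX d) * A) (δB d (aX d) ^ 2 * X))
      (2 - d) := by
    convert (YZHom.X (w := wt d) (R := ℤ) (s := sW d)).mul (YZHom_Gat d hx hy) using 1
    rw [sW]
    ring
  exact (h1.add h2).neg

/-- `reduceY` preserves the grading. [folklore] -/
theorem YZHom_reduceY {P : BE d} {W : ℤ} (hP : YZHom (wt d) (sW d) P W) :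
    YZHom (wt d) (sW d) (reduceY d (aX d) P) W :=
  YZHom.mapCoeffs (fun _ _ h => ZHom_reduce d h) hP

/-- The iterates `Ā_k` are graded of weight `2 - d`. [folklore] -/
theorem YZHom_Abar (k : ℕ) : YZHom (wt d) (sW d) (Abar d (aX d) k) (2 - d) := by
  induction k with
  | zero => exact YZHom.zero _
  | succ k ih =>
    rw [Abar_succ]
    exact (YZHom_reduceY d (YZHom_Nop d ih)).truncY _

/-- The column polynomial of `u_{ij}` is graded of weight `i`. [folklore] -/
theorem YZHom_colPoly (c : Idx d) : YZHom (wt d) (sW d) (colPoly d (aX d) c) (c.1 : ℕ) := by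
  unfold colPoly
  refine YZHom_reduceY d ?_
  have hx : YZHom (wt d) (sW d) (C X + δB d (aX d) * Abar d (aX d) (ℓ d)) 1 := by
    refine (YZHom.C ZHom.X).add ?_
    convert (YZHom_δB d).mul (YZHom_Abar d (ℓ d)) using 1
    ring
  have hy : YZHom (wt d) (sW d) (δB d (aX d) ^ 2 * X) 0 := by
    convert ((YZHom_δB d).pow 2).mul (YZHom.X (w := wt d) (R := ℤ) (s := sW d)) using 1
    rw [sW]
    push_cast
    ring
  convert (hx.pow c.1).mul (hy.pow c.2) using 1
  ring

/-- The entry `Mgen k (i, j)` is `z`-graded of weight `i + (2d-2) k`. [folklore] -/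
theorem ZHom_Mgen (k : Fin (ℓ d + 1)) (c : Idx d) :
    ZHom (wt d) (Mgen d (aX d) k c) ((c.1 : ℕ) + sW d * (k : ℕ)) :=
  YZHom_colPoly d c k

/-- The weight of the minor on rows `S`: `W_S = Σ_{c'} (2d-2) S c' + Σ_c c.1`. [folklore] -/
def minorWeight (S : Idx d → Fin (ℓ d + 1)) : ℤ :=
  ∑ c' : Idx d, sW d * (S c' : ℕ) + ∑ c : Idx d, ((c.1 : ℕ) : ℤ)

/-- The minor on rows `S` is `z`-graded of weight `W_S`. [folklore] -/
theorem ZHom_minor (S : Idx d → Fin (ℓ d + 1)) : ZHom (wt d) (minor d (aX d) S) (minorWeight d S) := by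
  unfold minor minorWeight
  refine ZHom.det (Matrix.of fun c' c : Idx d => Mgen d (aX d) (S c') c) (fun c' => sW d * (S c' : ℕ))
    (fun c => ((c.1 : ℕ) : ℤ)) fun c' c => ?_
  rw [Matrix.of_apply]
  convert ZHom_Mgen d (S c') c using 1
  ring

/-- `tauR (S, ι)` is weighted homogeneous of weight `W_S - ι` for the weights `w(c_{ij}) = d - i`.
[folklore] -/
theorem isWeightedHomogeneous_tauR (t : TIdx d) :
    IsWeightedHomogeneous (wt d) (tauR d (aX d) t) (minorWeight d t.1 - (t.2 : ℕ)) :=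
  ZHom_reduce d (ZHom_minor d t.1) t.2

/-- The uniform weight bound `Wτ d = |Idx d| · (2d-2) ℓ + (d+1) d²`. [folklore] -/
def Wτ (d : ℕ) : ℕ := d * (d + 1) * (2 * (d - 1)) * ℓ d + (d + 1) * (d * d)

/-- `W_S ≤ Wτ d`. [folklore] -/
theorem minorWeight_le (S : Idx d → Fin (ℓ d + 1)) : minorWeight d S ≤ (Wτ d : ℤ) := by
  unfold minorWeight Wτ
  rcases Nat.eq_zero_or_pos d with rfl | hd
  · simp
  have hs : 0 ≤ sW d := by
    rw [sW]
    omega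
  have h1 : ∑ c' : Idx d, sW d * (S c' : ℕ) ≤ ((d * (d + 1) * (2 * (d - 1)) * ℓ d : ℕ) : ℤ) := by
    calc ∑ c' : Idx d, sW d * (S c' : ℕ) ≤ ∑ _c' : Idx d, sW d * (ℓ d : ℕ) := by
          refine Finset.sum_le_sum fun c' _ => ?_
          exact mul_le_mul_of_nonneg_left (by exact_mod_cast Nat.lt_succ_iff.mp (S c').2) hs
      _ = ((d * (d + 1) * (2 * (d - 1)) * ℓ d : ℕ) : ℤ) := by
          rw [Finset.sum_const, Finset.card_univ, Fintype.card_prod, Fintype.card_fin, Fintype.card_fin,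
            sW, nsmul_eq_mul]
          push_cast [Nat.cast_sub hd]
          ring
  have h2 : ∑ c : Idx d, ((c.1 : ℕ) : ℤ) ≤ (((d + 1) * (d * d) : ℕ) : ℤ) := by
    calc ∑ c : Idx d, ((c.1 : ℕ) : ℤ) ≤ ∑ _c : Idx d, (d : ℤ) :=
          Finset.sum_le_sum fun c _ => by exact_mod_cast c.1.2.le
      _ = (((d + 1) * (d * d) : ℕ) : ℤ) := by
          rw [Finset.sum_const, Finset.card_univ, Fintype.card_prod, Fintype.card_fin, Fintype.card_fin,
            nsmul_eq_mul]
          push_cast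
          ring
  push_cast at h1 h2 ⊢
  linarith

end Weights

/-! ### `z`-degrees of `y`-coefficients -/

section ZDeg

variable {R : Type*} [CommRing R]

/-- `ZDeg P D`: every `y`-coefficient of `P ∈ R[z][y]` has `z`-degree `≤ D`. [folklore] -/
def ZDeg (P : Polynomial R[X]) (D : ℕ) : Prop := ∀ m, (P.coeff m).natDegree ≤ D

namespace ZDeg

/-- `0`. [folklore] -/
theorem zero (D : ℕ) : ZDeg (0 : Polynomial R[X]) D := fun m => by simp

/-- Monotonicity in the bound. [folklore] -/
theorem mono {P : Polynomial R[X]} {D D' : ℕ} (h : ZDeg P D) (hD : D ≤ D') : ZDeg P D' :=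
  fun m => (h m).trans hD

/-- Constants. [folklore] -/
theorem C {p : R[X]} {D : ℕ} (hp : p.natDegree ≤ D) : ZDeg (Polynomial.C p) D := fun m => by
  rw [coeff_C]
  split_ifs
  · exact hp
  · simp

/-- The variable `y`. [folklore] -/
theorem X (D : ℕ) : ZDeg (Polynomial.X : Polynomial R[X]) D := fun m => by
  rw [coeff_X]
  split_ifs <;> simp

/-- Sums. [folklore] -/
theorem add {P Q : Polynomial R[X]} {D : ℕ} (hP : ZDeg P D) (hQ : ZDeg Q D) : ZDeg (P + Q) D :=
  fun m => by
  rw [coeff_add]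
  exact (natDegree_add_le _ _).trans (max_le (hP m) (hQ m))

/-- Negation. [folklore] -/
theorem neg {P : Polynomial R[X]} {D : ℕ} (hP : ZDeg P D) : ZDeg (-P) D := fun m => by
  rw [coeff_neg, natDegree_neg]
  exact hP m

/-- Finite sums. [folklore] -/
theorem sum {ι : Type*} (s : Finset ι) (f : ι → Polynomial R[X]) (D : ℕ)
    (h : ∀ i ∈ s, ZDeg (f i) D) : ZDeg (∑ i ∈ s, f i) D := by
  classical
  induction s using Finset.induction_on with
  | empty => simpa using ZDeg.zero (R := R) D
  | insert a s ha ih =>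
    rw [Finset.sum_insert ha]
    exact (h a (Finset.mem_insert_self a s)).add (ih fun i hi => h i (Finset.mem_insert_of_mem hi))

/-- Products: bounds add. [folklore] -/
theorem mul {P Q : Polynomial R[X]} {D D' : ℕ} (hP : ZDeg P D) (hQ : ZDeg Q D') :
    ZDeg (P * Q) (D + D') := fun m => by
  rw [coeff_mul]
  refine natDegree_sum_le_of_forall_le _ _ fun x _ => natDegree_mul_le.trans ?_
  exact add_le_add (hP _) (hQ _)

/-- Powers. [folklore] -/
theorem pow {P : Polynomial R[X]} {D : ℕ} (hP : ZDeg P D) (n : ℕ) : ZDeg (P ^ n) (n * D) := by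
  induction n with
  | zero => simpa using ZDeg.C (R := R) (p := 1) (D := 0) (by simp)
  | succ n ih =>
    rw [pow_succ, Nat.succ_mul]
    exact ih.mul hP

/-- Powers with a uniform bound `n ≤ N`. [folklore] -/
theorem pow_le {P : Polynomial R[X]} {D : ℕ} (hP : ZDeg P D) {n N : ℕ} (hn : n ≤ N) :
    ZDeg (P ^ n) (N * D) :=
  (hP.pow n).mono (Nat.mul_le_mul_right _ hn)

/-- `eval₂ C H Q`. [folklore] -/
theorem eval₂_C {Q H : Polynomial R[X]} {DQ DH NQ : ℕ} (hQ : ∀ n, (Q.coeff n).natDegree ≤ DQ)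
    (hNQ : Q.natDegree ≤ NQ) (hH : ZDeg H DH) : ZDeg (Q.eval₂ Polynomial.C H) (DQ + NQ * DH) := by
  rw [eval₂_eq_sum, Polynomial.sum_def]
  refine ZDeg.sum _ _ _ fun n hn => ?_
  exact (ZDeg.C (hQ n)).mul (hH.pow_le (le_natDegree_of_mem_supp n hn |>.trans hNQ))

/-- Truncation. [folklore] -/
theorem truncY {P : Polynomial R[X]} {D : ℕ} (hP : ZDeg P D) (m : ℕ) : ZDeg (truncY m P) D := fun n => by
  rw [coeff_truncY]
  split_ifs
  · exact hP n
  · simp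

end ZDeg

/-- Reduced polynomials have `z`-degrees `≤ d - 1` (`d ≥ 1`). [folklore] -/
theorem ZDeg_reduceY (hd : 0 < d) (a : Idx d → R) (P : Polynomial R[X]) :
    ZDeg (reduceY d a P) (d - 1) := fun m => by
  rw [coeff_reduceY]
  have := natDegree_reduce_lt d a hd (P.coeff m)
  omega

/-- The iterates are reduced. [folklore] -/
theorem ZDeg_Abar (hd : 0 < d) (a : Idx d → R) (k : ℕ) : ZDeg (Abar d a k) (d - 1) := by
  cases k with
  | zero => exact ZDeg.zero _
  | succ k =>
    rw [Abar_succ]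
    exact (ZDeg_reduceY d hd a _).truncY _

/-- `deg δ̂ ≤ d`. [folklore] -/
theorem natDegree_deltaHat_le (a : Idx d → R) : (deltaHat d a).natDegree ≤ d :=
  (natDegree_derivative_le _).trans ((Nat.sub_le _ _).trans (natDegree_genF0_le d a))

/-- The coefficients of `genQ` have degree `≤ d` and vanish above `hⁿ`, `n > d`. [folklore] -/
theorem natDegree_coeff_genQ_le (a : Idx d → R) (n : ℕ) : ((genQ d a).coeff n).natDegree ≤ d := by
  rw [coeff_genQ]
  exact (natDegree_hasseDeriv_le _ _).trans ((Nat.sub_le _ _).trans (natDegree_genF0_le d a))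

/-- `deg_h genQ ≤ d`. [folklore] -/
theorem natDegree_genQ_le (a : Idx d → R) : (genQ d a).natDegree ≤ d := by
  refine natDegree_le_iff_coeff_eq_zero.mpr fun n hn => ?_
  rw [coeff_genQ]
  refine hasseDeriv_eq_zero_of_lt_natDegree _ _ ?_
  exact (natDegree_genF0_le d a).trans_lt (by omega)

/-- The crude uniform `z`-degree bound `Dz d = 4d² + 3d` for one step of the iteration. [folklore] -/
def Dz (d : ℕ) : ℕ := 4 * d ^ 2 + 3 * d

/-- `Nop` of a reduced element has `z`-degrees `≤ Dz d`. [folklore] -/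
theorem ZDeg_Nop (hd : 0 < d) (a : Idx d → R) {A : Polynomial R[X]} (hA : ZDeg A d) :
    ZDeg (Nop d a A) (Dz d) := by
  unfold Nop Dz
  have hδ : ZDeg (δB d a) d := ZDeg.C (natDegree_deltaHat_le d a)
  have hδA : ZDeg (δB d a * A) (2 * d) := by simpa [two_mul] using hδ.mul hA
  have hx : ZDeg (C Polynomial.X + δB d a * A) (2 * d) := by
    refine ZDeg.add (ZDeg.C (natDegree_X_le.trans ?_)) hδA
    omega
  have hy : ZDeg (δB d a ^ 2 * Polynomial.X) (2 * d) := by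
    simpa [two_mul] using (hδ.pow 2).mul (ZDeg.X (R := R) 0)
  have h1 : ZDeg (A ^ 2 * (genQ d a).eval₂ C (δB d a * A)) (2 * d + (d + d * (2 * d))) :=
    (hA.pow 2).mul (ZDeg.eval₂_C (natDegree_coeff_genQ_le d a) (natDegree_genQ_le d a) hδA)
  have h2 : ZDeg (Polynomial.X * Gat d (cB ∘ a) (C Polynomial.X + δB d a * A) (δB d a ^ 2 * Polynomial.X))
      (0 + (0 + d * (2 * d) + d * (2 * d))) := by
    refine (ZDeg.X 0).mul (ZDeg.sum _ _ _ fun ij _ => ?_)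
    refine (ZDeg.mul ?_ (hx.pow_le ij.1.2.le)).mul (hy.pow_le ij.2.2.le)
    exact ZDeg.C (by simp)
  refine ((h1.mono ?_).add (h2.mono ?_)).neg <;> nlinarith

end ZDeg

/-! ### Norms on `E₂[z]` -/

section NormsZ

/-- Kaltofen's `1`-norm on `E₂[z]` (`1`-norm in the `c's` and `z` jointly). [cite: Kaltofen1995, §3 (1-norms)] -/
def νz (d : ℕ) : RingSeminorm (RzE d) := (l1Seminorm (Idx d)).polynomial 1 zero_le_one

/-- Unfolding. [folklore] -/
theorem νz_apply (P : RzE d) : νz d P = ∑ i ∈ P.support, (l1Norm (P.coeff i) : ℝ) := by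
  rw [νz, RingSeminorm.polynomial_apply, polyNorm]
  simp

/-- `νz` of a constant. [folklore] -/
@[simp] theorem νz_C (e : E₂ d) : νz d (C e) = l1Norm e := by
  rw [νz, RingSeminorm.polynomial_apply, polyNorm_C, l1Seminorm_apply]

/-- `νz 1 = 1`. [folklore] -/
@[simp] theorem νz_one : νz d 1 = 1 := by
  rw [← C_1, νz_C, l1Norm_one, Nat.cast_one]

/-- `νz z = 1`. [folklore] -/
@[simp] theorem νz_X : νz d X = 1 := by
  rw [νz, RingSeminorm.polynomial_apply, ← monomial_one_one_eq_X, polyNorm_monomial, l1Seminorm_apply,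
    l1Norm_one]
  simp

/-- `νz (z^k) = 1`. [folklore] -/
@[simp] theorem νz_X_pow (k : ℕ) : νz d (X ^ k) = 1 := by
  rw [νz, RingSeminorm.polynomial_apply, X_pow_eq_monomial, polyNorm_monomial, l1Seminorm_apply, l1Norm_one]
  simp

/-- Coefficients are dominated: `‖P_i‖₁ ≤ νz P`. [folklore] -/
theorem l1Norm_coeff_le_νz (P : RzE d) (i : ℕ) : (l1Norm (P.coeff i) : ℝ) ≤ νz d P := by
  have := le_polyNorm (l1Seminorm (Idx d)) zero_le_one P i
  rwa [one_pow, mul_one, l1Seminorm_apply] at this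

/-- `νz` is non-negative. [folklore] -/
theorem νz_nonneg (P : RzE d) : 0 ≤ νz d P := apply_nonneg _ _

/-- Powers. [folklore] -/
theorem νz_pow_le (P : RzE d) (n : ℕ) : νz d (P ^ n) ≤ νz d P ^ n :=
  polyNorm_pow_le _ zero_le_one (by rw [l1Seminorm_apply, l1Norm_one, Nat.cast_one]) P n

/-- Finite sums. [folklore] -/
theorem νz_sum_le {ι : Type*} (s : Finset ι) (f : ι → RzE d) : νz d (∑ i ∈ s, f i) ≤ ∑ i ∈ s, νz d (f i) :=
  polyNorm_sum_le _ zero_le_one s f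

/-- `νz genF0 ≤ d + 1`. [folklore] -/
theorem νz_genF0_le : νz d (genF0 d (aX d)) ≤ d + 1 := by
  unfold genF0
  refine (map_add_le_add (νz d) _ _).trans ?_
  rw [νz_X_pow, add_comm]
  refine add_le_add ((νz_sum_le d _ _).trans ?_) le_rfl
  calc ∑ i : Fin d, νz d (C (aX d (i, 0)) * X ^ (i : ℕ)) ≤ ∑ _i : Fin d, (1 : ℝ) := by
        refine Finset.sum_le_sum fun i _ => (map_mul_le_mul (νz d) _ _).trans ?_
        rw [νz_C, νz_X_pow, mul_one, aX, l1Norm_X, Nat.cast_one]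
    _ = d := by simp

/-- Hasse derivatives: `νz (D^{(k)} P) ≤ 2^D νz P` for `deg P ≤ D`. [folklore] -/
theorem νz_hasseDeriv_le (k : ℕ) {P : RzE d} {D : ℕ} (hP : P.natDegree ≤ D) :
    νz d (hasseDeriv k P) ≤ 2 ^ D * νz d P := by
  rw [hasseDeriv_apply, Polynomial.sum_def]
  refine (νz_sum_le d _ _).trans ?_
  rw [νz_apply d P, Finset.mul_sum]
  refine Finset.sum_le_sum fun i hi => ?_
  rw [νz, RingSeminorm.polynomial_apply, polyNorm_monomial, one_pow, mul_one, l1Seminorm_apply,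
    ← map_natCast (MvPolynomial.C : ℤ →+* E₂ d)]
  have h1 : (l1Norm (MvPolynomial.C ((i.choose k : ℕ) : ℤ) * P.coeff i) : ℝ) ≤
      (i.choose k) * l1Norm (P.coeff i) := by
    have := l1Norm_mul_le (MvPolynomial.C ((i.choose k : ℕ) : ℤ)) (P.coeff i)
    rw [l1Norm_C, Int.natAbs_natCast] at this
    exact_mod_cast this
  refine h1.trans (mul_le_mul_of_nonneg_right ?_ (Nat.cast_nonneg _))
  have h2 : i.choose k ≤ 2 ^ D :=
    (Nat.choose_le_two_pow i k).trans (Nat.pow_le_pow_right two_pos ((le_natDegree_of_mem_supp i hi).trans hP))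
  exact_mod_cast h2

/-- `νz (P - Q) ≤ νz P + νz Q`. [folklore] -/
theorem νz_sub_le (P Q : RzE d) : νz d (P - Q) ≤ νz d P + νz d Q := by
  have h := map_add_le_add (νz d) P (-Q)
  rwa [map_neg_eq_map, ← sub_eq_add_neg] at h

/-- `νz (zpow k) ≤ (d+2)^k` (cf. Kaltofen, Lemma 1: `‖b_{j,ι}‖₁ ≤ (d+1)^{j+1-d}`). [cite: Kaltofen1995, Lemma 1] -/
theorem νz_zpow_le (k : ℕ) : νz d (zpow d (aX d) k) ≤ ((d : ℝ) + 2) ^ k := by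
  induction k with
  | zero => simp
  | succ k ih =>
    rw [zpow_succ]
    set z : RzE d := zpow d (aX d) k with hz
    set q : RzE d := X * z with hqdef
    set g : RzE d := genF0 d (aX d) with hg
    set c : E₂ d := q.coeff d with hcdef
    have hq : νz d q ≤ νz d z := by
      have h := map_mul_le_mul (νz d) (X : RzE d) z
      rwa [νz_X, one_mul] at h
    have h2 : νz d (C c) ≤ νz d z := by
      rw [νz_C]
      exact (l1Norm_coeff_le_νz d q d).trans hq
    have hc : νz d (C c * g) ≤ νz d z * ((d : ℝ) + 1) := by
      have h1 := map_mul_le_mul (νz d) (C c) g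
      have h3 : νz d g ≤ (d : ℝ) + 1 := νz_genF0_le d
      have h4 : 0 ≤ νz d g := νz_nonneg d g
      have h5 : 0 ≤ νz d z := νz_nonneg d z
      exact h1.trans (mul_le_mul h2 h3 h4 h5)
    calc νz d (q - C c * g) ≤ νz d z + νz d z * ((d : ℝ) + 1) := (νz_sub_le d _ _).trans (add_le_add hq hc)
      _ = νz d z * ((d : ℝ) + 2) := by ring
      _ ≤ ((d : ℝ) + 2) ^ k * ((d : ℝ) + 2) := mul_le_mul_of_nonneg_right ih (by positivity)
      _ = ((d : ℝ) + 2) ^ (k + 1) := by rw [pow_succ]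

/-- `νz (reduce P) ≤ (d+2)^D νz P` when `deg P ≤ D` (Kaltofen, Lemma 1). [cite: Kaltofen1995, Lemma 1] -/
theorem νz_reduce_le {P : RzE d} {D : ℕ} (hP : P.natDegree ≤ D) :
    νz d (reduce d (aX d) P) ≤ ((d : ℝ) + 2) ^ D * νz d P := by
  rw [reduce_apply]
  refine (νz_sum_le d _ _).trans ?_
  rw [νz_apply d P, Finset.mul_sum]
  refine Finset.sum_le_sum fun k hk => ?_
  have h1 := map_mul_le_mul (νz d) (C (P.coeff k)) (zpow d (aX d) k)
  rw [νz_C] at h1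
  refine h1.trans ?_
  rw [mul_comm]
  refine mul_le_mul_of_nonneg_right ((νz_zpow_le d k).trans ?_) (Nat.cast_nonneg _)
  exact pow_le_pow_right₀ (by linarith) ((le_natDegree_of_mem_supp k hk).trans hP)

/-- The constant `cδ d = 2^d (d+1) ≥ νz δ̂`. [folklore] -/
def cδ (d : ℕ) : ℕ := 2 ^ d * (d + 1)

/-- `νz δ̂ ≤ cδ d`. [folklore] -/
theorem νz_deltaHat_le : νz d (deltaHat d (aX d)) ≤ cδ d := by
  rw [deltaHat, ← hasseDeriv_one, cδ]
  push_cast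
  exact (νz_hasseDeriv_le d 1 (natDegree_genF0_le d (aX d))).trans
    (mul_le_mul_of_nonneg_left (νz_genF0_le d) (by positivity))

/-- Each `hⁿ`-coefficient of `genQ` has `νz ≤ cδ d`. [folklore] -/
theorem νz_coeff_genQ_le (n : ℕ) : νz d ((genQ d (aX d)).coeff n) ≤ cδ d := by
  rw [coeff_genQ, cδ]
  push_cast
  exact (νz_hasseDeriv_le d _ (natDegree_genF0_le d (aX d))).trans
    (mul_le_mul_of_nonneg_left (νz_genF0_le d) (by positivity))

/-- The constant `cQ d = (d+1) cδ d ≥ Σₙ νz (genQ_n)`. [folklore] -/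
def cQ (d : ℕ) : ℕ := (d + 1) * cδ d

/-- `Σ_{n ∈ supp genQ} νz (genQ_n) ≤ cQ d`. [folklore] -/
theorem sum_νz_coeff_genQ_le : ∑ n ∈ (genQ d (aX d)).support, νz d ((genQ d (aX d)).coeff n) ≤ cQ d := by
  calc ∑ n ∈ (genQ d (aX d)).support, νz d ((genQ d (aX d)).coeff n)
        ≤ ∑ n ∈ Finset.range (d + 1), νz d ((genQ d (aX d)).coeff n) := by
          refine Finset.sum_le_sum_of_subset_of_nonneg ?_ fun _ _ _ => νz_nonneg d _
          intro n hn
          exact Finset.mem_range.mpr (Nat.lt_succ_of_le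
            ((le_natDegree_of_mem_supp n hn).trans (natDegree_genQ_le d (aX d))))
    _ ≤ ∑ _n ∈ Finset.range (d + 1), (cδ d : ℝ) := Finset.sum_le_sum fun n _ => νz_coeff_genQ_le d n
    _ = cQ d := by rw [Finset.sum_const, Finset.card_range, nsmul_eq_mul, cQ]; push_cast; ring

end NormsZ

/-! ### Norms on `E₂[z][y]`: the contraction estimate -/

section NormsY

/-- The `t`-weighted `1`-norm on `E₂[z][y]`. [folklore] -/
def νy (d : ℕ) (t : ℝ) (ht : 0 ≤ t) : RingSeminorm (BE d) := (νz d).polynomial t ht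

variable {t : ℝ} (ht : 0 ≤ t)

/-- `νy` of a constant. [folklore] -/
@[simp] theorem νy_C (P : RzE d) : νy d t ht (C P) = νz d P := by
  rw [νy, RingSeminorm.polynomial_apply, polyNorm_C]

/-- `νy y = t`. [folklore] -/
@[simp] theorem νy_X : νy d t ht X = t := by
  rw [νy, RingSeminorm.polynomial_apply, ← monomial_one_one_eq_X, polyNorm_monomial, νz_one, one_mul, pow_one]

/-- `νy` is non-negative. [folklore] -/
theorem νy_nonneg (P : BE d) : 0 ≤ νy d t ht P := apply_nonneg _ _

/-- Powers. [folklore] -/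
theorem νy_pow_le (P : BE d) (n : ℕ) : νy d t ht (P ^ n) ≤ νy d t ht P ^ n :=
  polyNorm_pow_le _ ht (by rw [νz_one]) P n

/-- Finite sums. [folklore] -/
theorem νy_sum_le {ι : Type*} (s : Finset ι) (f : ι → BE d) :
    νy d t ht (∑ i ∈ s, f i) ≤ ∑ i ∈ s, νy d t ht (f i) :=
  polyNorm_sum_le _ ht s f

/-- Coefficients are dominated: `νz P_m · t^m ≤ νy P`. [folklore] -/
theorem νz_coeff_mul_le_νy (P : BE d) (m : ℕ) : νz d (P.coeff m) * t ^ m ≤ νy d t ht P :=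
  le_polyNorm (νz d) ht P m

/-- `reduceY` costs at most `(d+2)^D` when the `z`-degrees are `≤ D`. [cite: Kaltofen1995, Lemma 1] -/
theorem νy_reduceY_le {P : BE d} {D : ℕ} (hP : ZDeg P D) :
    νy d t ht (reduceY d (aX d) P) ≤ ((d : ℝ) + 2) ^ D * νy d t ht P := by
  rw [νy, RingSeminorm.polynomial_apply, RingSeminorm.polynomial_apply, reduceY]
  exact polyNorm_mapCoeffs_le (νz d) ht (reduce d (aX d)) P fun i => νz_reduce_le d (hP i)

/-- Truncation does not increase `νy`. [folklore] -/
theorem νy_truncY_le (P : BE d) (m : ℕ) : νy d t ht (truncY m P) ≤ νy d t ht P :=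
  polyNorm_truncY_le (νz d) ht m P

/-- `νy (eval₂ C H Q) ≤ Σₙ νz(Qₙ) νy(H)ⁿ`. [folklore] -/
theorem νy_eval₂_C_le (Q H : BE d) :
    νy d t ht (Q.eval₂ C H) ≤ ∑ n ∈ Q.support, νz d (Q.coeff n) * νy d t ht H ^ n := by
  rw [eval₂_eq_sum, Polynomial.sum_def]
  refine (νy_sum_le d ht _ _).trans (Finset.sum_le_sum fun n _ => ?_)
  refine (map_mul_le_mul (νy d t ht) _ _).trans ?_
  rw [νy_C]
  exact mul_le_mul_of_nonneg_left (νy_pow_le d ht H n) (νz_nonneg d _)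

/-- The constant `cG d = d² 2^d ≥ νy (Gat x y)` for `νy x ≤ 2`, `νy y ≤ 1`. [folklore] -/
def cG (d : ℕ) : ℕ := d * d * 2 ^ d

/-- `νy (Gat x y) ≤ cG d` when `νy x ≤ 2` and `νy y ≤ 1`. [folklore] -/
theorem νy_Gat_le {x y : BE d} (hx : νy d t ht x ≤ 2) (hy : νy d t ht y ≤ 1) :
    νy d t ht (Gat d (cB ∘ aX d) x y) ≤ cG d := by
  unfold Gat cG
  refine (νy_sum_le d ht _ _).trans ?_
  calc ∑ ij : Fin d × Fin d, νy d t ht ((cB ∘ aX d) (ij.1, ij.2.succ) * x ^ (ij.1 : ℕ) * y ^ (ij.2 : ℕ))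
        ≤ ∑ _ij : Fin d × Fin d, (2 : ℝ) ^ d := by
          refine Finset.sum_le_sum fun ij _ => ?_
          set e : BE d := (cB ∘ aX d) (ij.1, ij.2.succ) with he
          have h0 : νy d t ht e = 1 := by
            rw [he, Function.comp_apply, RingHom.comp_apply, νy_C, νz_C, aX, l1Norm_X, Nat.cast_one]
          have h1 := map_mul_le_mul (νy d t ht) (e * x ^ (ij.1 : ℕ)) (y ^ (ij.2 : ℕ))
          have h2 := map_mul_le_mul (νy d t ht) e (x ^ (ij.1 : ℕ))
          have h3 : νy d t ht (x ^ (ij.1 : ℕ)) ≤ (2 : ℝ) ^ d :=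
            (νy_pow_le d ht x _).trans ((pow_le_pow_left₀ (νy_nonneg d ht x) hx _).trans
              (pow_le_pow_right₀ one_le_two ij.1.2.le))
          have h4 : νy d t ht (y ^ (ij.2 : ℕ)) ≤ 1 :=
            (νy_pow_le d ht y _).trans (pow_le_one₀ (νy_nonneg d ht y) hy)
          have h5 := νy_nonneg d ht (y ^ (ij.2 : ℕ))
          have h6 := νy_nonneg d ht (x ^ (ij.1 : ℕ))
          calc νy d t ht (e * x ^ (ij.1 : ℕ) * y ^ (ij.2 : ℕ))
                ≤ νy d t ht e * νy d t ht (x ^ (ij.1 : ℕ)) * νy d t ht (y ^ (ij.2 : ℕ)) :=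
                  h1.trans (mul_le_mul_of_nonneg_right h2 h5)
            _ ≤ 1 * (2 : ℝ) ^ d * 1 := by
                  rw [h0]
                  exact mul_le_mul (mul_le_mul_of_nonneg_left h3 zero_le_one) h4 h5 (by positivity)
            _ = (2 : ℝ) ^ d := by ring
    _ = (d * d * 2 ^ d : ℕ) := by
          rw [Finset.sum_const, Finset.card_univ, Fintype.card_prod, Fintype.card_fin, nsmul_eq_mul]
          push_cast
          ring

/-- The reduction cost of one iteration step: `cR d = (d+2)^{Dz d}`. [folklore] -/
def cR (d : ℕ) : ℕ := (d + 2) ^ Dz d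

/-- One step of the iteration in norm: if `νy A ≤ b` with `cδ b ≤ 1` and `cδ² t ≤ 1` then
`νy (Nop A) ≤ b² cQ + t cG`. [folklore] -/
theorem νy_Nop_le {A : BE d} {b : ℝ} (hA : νy d t ht A ≤ b) (hb : (cδ d : ℝ) * b ≤ 1)
    (htδ : (cδ d : ℝ) ^ 2 * t ≤ 1) :
    νy d t ht (Nop d (aX d) A) ≤ b ^ 2 * cQ d + t * cG d := by
  have hb0 : 0 ≤ b := (νy_nonneg d ht A).trans hA
  set δ : BE d := δB d (aX d) with hδdef
  have hδ : νy d t ht δ ≤ cδ d := by rw [hδdef, δB, νy_C]; exact νz_deltaHat_le d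
  set H : BE d := δ * A with hH
  have hHle : νy d t ht H ≤ 1 := by
    have h1 := map_mul_le_mul (νy d t ht) δ A
    exact h1.trans ((mul_le_mul hδ hA (νy_nonneg d ht A) (Nat.cast_nonneg _)).trans hb)
  set Q : BE d := genQ d (aX d) with hQ
  set E : BE d := Q.eval₂ C H with hE
  have hEle : νy d t ht E ≤ cQ d := by
    refine (νy_eval₂_C_le d ht Q H).trans ((Finset.sum_le_sum fun n _ => ?_).trans (sum_νz_coeff_genQ_le d))
    calc νz d (Q.coeff n) * νy d t ht H ^ n ≤ νz d (Q.coeff n) * 1 :=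
          mul_le_mul_of_nonneg_left (pow_le_one₀ (νy_nonneg d ht H) hHle) (νz_nonneg d _)
      _ = νz d (Q.coeff n) := mul_one _
  set x : BE d := C X + H with hx
  have hxle : νy d t ht x ≤ 2 := by
    have h1 := map_add_le_add (νy d t ht) (C X) H
    rw [νy_C, νz_X] at h1
    linarith
  set y : BE d := δ ^ 2 * X with hy
  have hyle : νy d t ht y ≤ 1 := by
    have h1 := map_mul_le_mul (νy d t ht) (δ ^ 2) X
    rw [νy_X] at h1
    refine h1.trans (le_trans ?_ htδ)
    exact mul_le_mul_of_nonneg_right ((νy_pow_le d ht δ 2).trans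
      (pow_le_pow_left₀ (νy_nonneg d ht δ) hδ 2)) ht
  set G : BE d := Gat d (cB ∘ aX d) x y with hG
  have hGle : νy d t ht G ≤ cG d := νy_Gat_le d ht hxle hyle
  have h1 : νy d t ht (A ^ 2 * E) ≤ b ^ 2 * cQ d := by
    have h := map_mul_le_mul (νy d t ht) (A ^ 2) E
    refine h.trans (mul_le_mul ((νy_pow_le d ht A 2).trans (pow_le_pow_left₀ (νy_nonneg d ht A) hA 2))
      hEle (νy_nonneg d ht E) (by positivity))
  have h2 : νy d t ht (X * G) ≤ t * cG d := by
    have h := map_mul_le_mul (νy d t ht) X G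
    rw [νy_X] at h
    exact h.trans (mul_le_mul_of_nonneg_left hGle ht)
  have h3 := map_add_le_add (νy d t ht) (A ^ 2 * E) (X * G)
  have h4 : νy d t ht (Nop d (aX d) A) = νy d t ht (A ^ 2 * E + X * G) := by
    have e : Nop d (aX d) A = -(A ^ 2 * E + X * G) := rfl
    rw [e]
    exact map_neg_eq_map (νy d t ht) (A ^ 2 * E + X * G)
  linarith

/-- `T d = 4 cR² cQ cδ cG`, the reciprocal of the weight `t` at which the iteration contracts; the
`y^m`-coefficients of the iterates have norm `≤ T^m` (our replacement for Kaltofen's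
`B₀(d, k) = (2d)^{(6d+2)(2k-1)}`, Thm. 1). [cite: Kaltofen1995, Thm. 1] -/
def Tc (d : ℕ) : ℕ := 4 * cR d ^ 2 * cQ d * cδ d * cG d

/-- The contraction radius `β = 1 / (2 cR cQ cδ)`. [folklore] -/
def βc (d : ℕ) : ℝ := 1 / (2 * cR d * cQ d * cδ d)

/-- The weight `t = 1 / T`. [folklore] -/
def tc (d : ℕ) : ℝ := 1 / Tc d

/-- `1 ≤ cδ`. [folklore] -/
theorem one_le_cδ : 1 ≤ cδ d := Nat.one_le_iff_ne_zero.mpr (by unfold cδ; positivity)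

/-- `1 ≤ cQ`. [folklore] -/
theorem one_le_cQ : 1 ≤ cQ d := Nat.one_le_iff_ne_zero.mpr (by unfold cQ cδ; positivity)

/-- `1 ≤ cR`. [folklore] -/
theorem one_le_cR : 1 ≤ cR d := Nat.one_le_iff_ne_zero.mpr (by unfold cR; positivity)

/-- `1 ≤ cG` for `d ≥ 1`. [folklore] -/
theorem one_le_cG (hd : 0 < d) : 1 ≤ cG d := Nat.one_le_iff_ne_zero.mpr (by unfold cG; positivity)

/-- `1 ≤ T` for `d ≥ 1`. [folklore] -/
theorem one_le_Tc (hd : 0 < d) : 1 ≤ Tc d := by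
  have := one_le_cR d; have := one_le_cQ d; have := one_le_cδ d; have := one_le_cG d hd
  unfold Tc
  exact Nat.one_le_iff_ne_zero.mpr (by positivity)

/-- `0 ≤ t`. [folklore] -/
theorem tc_nonneg : 0 ≤ tc d := by unfold tc; positivity

/-- `0 < β`. [folklore] -/
theorem βc_pos : 0 < βc d := by
  have := one_le_cR d; have := one_le_cQ d; have := one_le_cδ d
  unfold βc
  positivity

/-- The three inequalities behind the contraction. [folklore] -/
theorem contraction_ineqs (hd : 0 < d) :
    (cδ d : ℝ) * βc d ≤ 1 ∧ (cδ d : ℝ) ^ 2 * tc d ≤ 1 ∧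
      (cR d : ℝ) * (βc d ^ 2 * cQ d + tc d * cG d) ≤ βc d ∧ βc d ≤ 1 := by
  have hR : (1 : ℝ) ≤ cR d := by exact_mod_cast one_le_cR d
  have hQ : (1 : ℝ) ≤ cQ d := by exact_mod_cast one_le_cQ d
  have hδ : (1 : ℝ) ≤ cδ d := by exact_mod_cast one_le_cδ d
  have hG : (1 : ℝ) ≤ cG d := by exact_mod_cast one_le_cG d hd
  have hQδ : (cδ d : ℝ) ≤ cQ d := by
    have : cδ d ≤ cQ d := by unfold cQ; nlinarith [one_le_cδ d]
    exact_mod_cast this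
  have hT : (Tc d : ℝ) = 4 * (cR d : ℝ) ^ 2 * cQ d * cδ d * cG d := by unfold Tc; push_cast; ring
  have hRQ : (1 : ℝ) ≤ cR d * cQ d := one_le_mul_of_one_le_of_one_le hR hQ
  have hRRG : (1 : ℝ) ≤ (cR d : ℝ) ^ 2 * cG d :=
    one_le_mul_of_one_le_of_one_le (by nlinarith) hG
  refine ⟨?_, ?_, ?_, ?_⟩
  · unfold βc
    rw [mul_one_div, div_le_one (by positivity)]
    nlinarith [mul_le_mul_of_nonneg_left hRQ (zero_le_one.trans hδ)]
  · unfold tc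
    rw [hT, mul_one_div, div_le_one (by positivity)]
    have h1 : (cδ d : ℝ) * cδ d ≤ cQ d * cδ d := mul_le_mul_of_nonneg_right hQδ (zero_le_one.trans hδ)
    have h2 : (cQ d : ℝ) * cδ d * 1 ≤ cQ d * cδ d * ((cR d : ℝ) ^ 2 * cG d) :=
      mul_le_mul_of_nonneg_left hRRG (by positivity)
    nlinarith
  · unfold βc tc
    rw [hT]
    rw [show (cR d : ℝ) * ((1 / (2 * cR d * cQ d * cδ d)) ^ 2 * cQ d +
        1 / (4 * (cR d : ℝ) ^ 2 * cQ d * cδ d * cG d) * cG d) =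
        (1 / (2 * cR d * cQ d * cδ d)) * (1 / (2 * cδ d) + 1 / 2) by
      field_simp
      ring]
    refine mul_le_of_le_one_right (by positivity) ?_
    rw [div_add_div _ _ (by positivity) (by positivity), div_le_one (by positivity)]
    nlinarith
  · unfold βc
    rw [div_le_one (by positivity)]
    nlinarith [mul_le_mul hR hQ zero_le_one (zero_le_one.trans hR)]

/-- THE CONTRACTION: `νy_t (Ā_k) ≤ β` for `t = 1/T` (Kaltofen's Thm. 1 / Cor. 1 in our
normalisation). [cite: Kaltofen1995, Thm. 1] -/
theorem νy_Abar_le (hd : 0 < d) (k : ℕ) : νy d (tc d) (tc_nonneg d) (Abar d (aX d) k) ≤ βc d := by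
  obtain ⟨hb, htδ, hcon, -⟩ := contraction_ineqs d hd
  induction k with
  | zero =>
    rw [Abar_zero]
    exact (AddGroupSeminormClass.map_zero (νy d (tc d) (tc_nonneg d))).le.trans (βc_pos d).le
  | succ k ih =>
    rw [Abar_succ]
    set A : BE d := Abar d (aX d) k with hA
    have hZ : ZDeg (Nop d (aX d) A) (Dz d) := ZDeg_Nop d hd (aX d) ((ZDeg_Abar d hd (aX d) k).mono (Nat.sub_le d 1))
    have h1 := νy_truncY_le d (tc_nonneg d) (reduceY d (aX d) (Nop d (aX d) A)) (k + 2)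
    have h2 := νy_reduceY_le d (tc_nonneg d) hZ
    have h3 := νy_Nop_le d (tc_nonneg d) ih hb htδ
    have hcR : ((d : ℝ) + 2) ^ Dz d = cR d := by unfold cR; push_cast; ring
    rw [hcR] at h2
    have h4 : (0 : ℝ) ≤ cR d := Nat.cast_nonneg _
    nlinarith

/-- COEFFICIENT NORMS OF THE TRUNCATED ROOT: `‖[y^m] Ā_k‖₁ ≤ T^m`. [cite: Kaltofen1995, Thm. 1 / Cor. 1] -/
theorem νz_coeff_Abar_le (hd : 0 < d) (k m : ℕ) : νz d ((Abar d (aX d) k).coeff m) ≤ (Tc d : ℝ) ^ m := by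
  obtain ⟨-, -, -, hβ1⟩ := contraction_ineqs d hd
  have hT : (1 : ℝ) ≤ Tc d := by exact_mod_cast one_le_Tc d hd
  have h1 := νz_coeff_mul_le_νy d (tc_nonneg d) (Abar d (aX d) k) m
  have h2 := νy_Abar_le d hd k
  have ht : tc d ^ m * (Tc d : ℝ) ^ m = 1 := by
    rw [← mul_pow, tc, one_div, inv_mul_cancel₀ (by positivity), one_pow]
  have h3 : νz d ((Abar d (aX d) k).coeff m) * tc d ^ m ≤ 1 := h1.trans (h2.trans hβ1)
  calc νz d ((Abar d (aX d) k).coeff m) = νz d ((Abar d (aX d) k).coeff m) * tc d ^ m * (Tc d : ℝ) ^ m := by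
        rw [mul_assoc, ht, mul_one]
    _ ≤ 1 * (Tc d : ℝ) ^ m := mul_le_mul_of_nonneg_right h3 (by positivity)
    _ = (Tc d : ℝ) ^ m := one_mul _

/-- The entry bound `Ent d = cR 2^d T^ℓ`. [folklore] -/
def Ent (d : ℕ) : ℕ := cR d * 2 ^ d * Tc d ^ ℓ d

/-- ENTRIES: `νz (Mgen k c) ≤ Ent d` (Kaltofen, proof of Thm. 4: "each coefficient of `u_{i,l,j}` is
bounded … in 1-norm"). [cite: Kaltofen1995, Thm. 4 (proof)] -/
theorem νz_Mgen_le (hd : 0 < d) (k : Fin (ℓ d + 1)) (c : Idx d) : νz d (Mgen d (aX d) k c) ≤ Ent d := by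
  obtain ⟨hb, htδ, -, -⟩ := contraction_ineqs d hd
  have hT : (1 : ℝ) ≤ Tc d := by exact_mod_cast one_le_Tc d hd
  set δ : BE d := δB d (aX d) with hδdef
  have hδ : νy d (tc d) (tc_nonneg d) δ ≤ cδ d := by rw [hδdef, δB, νy_C]; exact νz_deltaHat_le d
  set A : BE d := Abar d (aX d) (ℓ d) with hA
  set x : BE d := C X + δ * A with hx
  set y : BE d := δ ^ 2 * X with hy
  set P : BE d := x ^ (c.1 : ℕ) * y ^ (c.2 : ℕ) with hP
  have hxle : νy d (tc d) (tc_nonneg d) x ≤ 2 := by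
    have h1 := map_add_le_add (νy d (tc d) (tc_nonneg d)) (C X) (δ * A)
    have h2 := map_mul_le_mul (νy d (tc d) (tc_nonneg d)) δ A
    rw [νy_C, νz_X] at h1
    have h3 := νy_Abar_le d hd (ℓ d)
    have h4 : νy d (tc d) (tc_nonneg d) (δ * A) ≤ 1 :=
      h2.trans ((mul_le_mul hδ h3 (νy_nonneg d _ A) (Nat.cast_nonneg _)).trans hb)
    linarith
  have hyle : νy d (tc d) (tc_nonneg d) y ≤ 1 := by
    have h1 := map_mul_le_mul (νy d (tc d) (tc_nonneg d)) (δ ^ 2) X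
    rw [νy_X] at h1
    refine h1.trans (le_trans ?_ htδ)
    exact mul_le_mul_of_nonneg_right ((νy_pow_le d (tc_nonneg d) δ 2).trans
      (pow_le_pow_left₀ (νy_nonneg d _ δ) hδ 2)) (tc_nonneg d)
  have hPle : νy d (tc d) (tc_nonneg d) P ≤ (2 : ℝ) ^ d := by
    have h1 := map_mul_le_mul (νy d (tc d) (tc_nonneg d)) (x ^ (c.1 : ℕ)) (y ^ (c.2 : ℕ))
    have h3 : νy d (tc d) (tc_nonneg d) (x ^ (c.1 : ℕ)) ≤ (2 : ℝ) ^ d :=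
      (νy_pow_le d _ x _).trans ((pow_le_pow_left₀ (νy_nonneg d _ x) hxle _).trans
        (pow_le_pow_right₀ one_le_two c.1.2.le))
    have h4 : νy d (tc d) (tc_nonneg d) (y ^ (c.2 : ℕ)) ≤ 1 :=
      (νy_pow_le d _ y _).trans (pow_le_one₀ (νy_nonneg d _ y) hyle)
    calc νy d (tc d) (tc_nonneg d) P ≤ (2 : ℝ) ^ d * 1 :=
          h1.trans (mul_le_mul h3 h4 (νy_nonneg d _ _) (by positivity))
      _ = (2 : ℝ) ^ d := mul_one _
  have hZ : ZDeg P (Dz d) := by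
    have hδZ : ZDeg δ d := ZDeg.C (natDegree_deltaHat_le d (aX d))
    have hxZ : ZDeg x (2 * d) := by
      refine ZDeg.add (ZDeg.C (natDegree_X_le.trans (by omega))) ?_
      simpa [two_mul] using hδZ.mul ((ZDeg_Abar d hd (aX d) (ℓ d)).mono (Nat.sub_le d 1))
    have hyZ : ZDeg y (2 * d) := by simpa [two_mul] using (hδZ.pow 2).mul (ZDeg.X (R := E₂ d) 0)
    refine ((hxZ.pow_le c.1.2.le).mul (hyZ.pow_le (Nat.lt_succ_iff.mp c.2.2))).mono ?_
    unfold Dz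
    nlinarith
  have h1 := νz_coeff_mul_le_νy d (tc_nonneg d) (colPoly d (aX d) c) k
  have h2 := νy_reduceY_le d (tc_nonneg d) hZ
  have hcR : ((d : ℝ) + 2) ^ Dz d = cR d := by unfold cR; push_cast; ring
  rw [hcR] at h2
  have hcol : colPoly d (aX d) c = reduceY d (aX d) P := rfl
  rw [← hcol] at h2
  have h3 : νz d (Mgen d (aX d) k c) * tc d ^ (k : ℕ) ≤ cR d * (2 : ℝ) ^ d :=
    h1.trans (h2.trans (mul_le_mul_of_nonneg_left hPle (Nat.cast_nonneg _)))
  have ht : tc d ^ (k : ℕ) * (Tc d : ℝ) ^ (k : ℕ) = 1 := by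
    rw [← mul_pow, tc, one_div, inv_mul_cancel₀ (by positivity), one_pow]
  calc νz d (Mgen d (aX d) k c) = νz d (Mgen d (aX d) k c) * tc d ^ (k : ℕ) * (Tc d : ℝ) ^ (k : ℕ) := by
        rw [mul_assoc, ht, mul_one]
    _ ≤ cR d * (2 : ℝ) ^ d * (Tc d : ℝ) ^ (k : ℕ) := mul_le_mul_of_nonneg_right h3 (by positivity)
    _ ≤ cR d * (2 : ℝ) ^ d * (Tc d : ℝ) ^ ℓ d := by
        refine mul_le_mul_of_nonneg_left (pow_le_pow_right₀ hT (Nat.lt_succ_iff.mp k.2)) (by positivity)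
    _ = Ent d := by unfold Ent; push_cast; ring

/-- The number of unknowns `N = |Idx d| = d (d+1)`. [cite: Kaltofen1995, Thm. 4 (`N(d)`)] -/
def Nu (d : ℕ) : ℕ := d * (d + 1)

/-- `|Idx d| = Nu d`. [folklore] -/
theorem card_Idx : Fintype.card (Idx d) = Nu d := by
  rw [Fintype.card_prod, Fintype.card_fin, Fintype.card_fin, Nu]

/-- The norm bound for the Stage I forms: `Bτ d = (d+2)^{N(d-1)} · N! · Ent^N`. [folklore] -/
def Bτ (d : ℕ) : ℕ := (d + 2) ^ (Nu d * (d - 1)) * (Nu d).factorial * Ent d ^ Nu d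

/-- MINORS: `νz (minor S) ≤ N! Ent^N` (Kaltofen, Thm. 4: `‖Δ‖₁ ≤ …` by minor expansion). [cite: Kaltofen1995, Thm. 4] -/
theorem νz_minor_le (hd : 0 < d) (S : Idx d → Fin (ℓ d + 1)) :
    νz d (minor d (aX d) S) ≤ (Nu d).factorial * (Ent d : ℝ) ^ Nu d := by
  have h := seminorm_det_le (νz d) (by rw [νz_one]) (Matrix.of fun c' c : Idx d => Mgen d (aX d) (S c') c)
    (fun _ => (Ent d : ℝ)) (fun _ => Nat.cast_nonneg _) (fun c' c => νz_Mgen_le d hd (S c') c)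
  rwa [Finset.prod_const, Finset.card_univ, card_Idx, ← minor] at h

/-- The minors have `z`-degree `≤ N (d - 1)`. [folklore] -/
theorem natDegree_minor_le (hd : 0 < d) {R : Type*} [CommRing R] (a : Idx d → R)
    (S : Idx d → Fin (ℓ d + 1)) : (minor d a S).natDegree ≤ Nu d * (d - 1) := by
  rw [minor, ← card_Idx]
  refine natDegree_det_le_of_le _ _ fun c' c => ?_
  rw [Matrix.of_apply, Mgen, colPoly, coeff_reduceY]
  have := natDegree_reduce_lt d a hd
    ((((C X + δB d a * Abar d a (ℓ d)) ^ (c.1 : ℕ) * (δB d a ^ 2 * X) ^ (c.2 : ℕ))).coeff (S c'))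
  omega

/-- **NORM OF THE STAGE I FORMS**: `‖tauR (S, ι)‖₁ ≤ Bτ d`. [cite: Kaltofen1995, Thm. 4] -/
theorem l1Norm_tauR_le (hd : 0 < d) (t : TIdx d) : l1Norm (tauR d (aX d) t) ≤ Bτ d := by
  have h1 := l1Norm_coeff_le_νz d (reduce d (aX d) (minor d (aX d) t.1)) t.2
  have h2 := νz_reduce_le d (natDegree_minor_le d hd (aX d) t.1)
  have h3 := νz_minor_le d hd t.1
  have h4 : (l1Norm (tauR d (aX d) t) : ℝ) ≤ Bτ d := by
    rw [tauR]
    refine h1.trans (h2.trans ?_)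
    unfold Bτ
    push_cast
    rw [mul_assoc]
    exact mul_le_mul_of_nonneg_left h3 (by positivity)
  exact_mod_cast h4

end NormsY

end Literature.RingTheory.MvPolynomial.NoetherForms
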